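import Mathlib.LinearAlgebra.Matrix.NonsingularInverse
import Mathlib.GroupTheory.SpecificGroups.Cyclic
import Literature.NumberTheory.GaloisRepresentations.CliffordTwistDichotomyCommutant
import Literature.NumberTheory.GaloisRepresentations.CyclicExtensionOfInvariantRep
import HarnessLib

/-!
# An irreducible representation with reducible restriction along a cyclic layer is twist-stable

Topic `NumberTheory/GaloisRepresentations`; namespace
`Literature.NumberTheory.GaloisRepresentations`.  Theorems only: **no definition and no named
fact is introduced**.

Let `f : H →ₜ* G` be an open embedding of topological groups with normal image and FINITE CYCLIC
quotient (a surjection `q : G →* Q` onto a finite cyclic group with `q g = 1 ↔ g ∈ f(H)`), `A` an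
algebraically closed topological field of characteristic zero, and `r : G →ₜ* GL_n(A)` an
IRREDUCIBLE framed continuous representation whose restriction `r ∘ f` to `H` is REDUCIBLE.  Then
`r` is isomorphic to a non-trivial twist of itself by a character of `Q`: there are a continuous
character `χ : G →ₜ* Aˣ`, trivial on `f(H)` but `χ ≠ 1`, and `P ∈ GL_n(A)` with
`P · r · P⁻¹ = r ⊗ χ` (`FramedRep.exists_twist_conj_of_not_isIrreducible_comp`).  Together with the
converse (`FramedRep.not_isIrreducible_comp_of_conj_eq_twist`, file
`TwistStableRestrictionReducible`) this is Clifford's dichotomy along a cyclic layer in twist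
form: **`r ∘ f` is irreducible iff `r ≇ r ⊗ χ` for every character `χ ≠ 1` of `G / f(H)`**.

Proof (the commutant argument; Clifford 1937, §§1–3).  Let `d = |Q|`, `τ₀ ∈ G` with `q τ₀` a
generator, so that `G = ⋃ₖ f(H) τ₀ᵏ` and `τ₀ ^ d = f(σ_d)`.  By Clifford's theorem `r ∘ f` is
semisimple (`Representation.isSemisimpleRepresentation_restrictSubgroup`), so, being reducible and
non-zero, its commutant `E = {T | T r(f h) = r(f h) T}` contains a non-scalar element: the
projection onto a proper non-trivial subrepresentation along an invariant complement
(`FramedRep.exists_comm_ne_algebraMap_of_not_isIrreducible`).  Conjugation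
`Φ : T ↦ r(τ₀) T r(τ₀)⁻¹` is a linear endomorphism of `E` (normality) with `Φ ^ d = 1`
(`r(τ₀)^d = r(f σ_d)` is centralised by `E`) whose fixed points are the scalars (Schur's lemma for
the irreducible `r`, `FramedRep.exists_eq_scalar_of_forall_commute`).  Averaging
`e = d⁻¹ ∑_{k<d} Φᵏ` (characteristic zero) projects `E` onto the scalars with `Φ`-stable kernel
`K ≠ 0`, and an eigenvector `T ∈ K` of `Φ` (`Module.End.exists_eigenvalue`, `A` algebraically
closed) has eigenvalue `ζ ≠ 1`, `ζ ^ d = 1` (`exists_conj_eq_smul_of_mem_centralizer`).  The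
character `χ` of `Q = ⟨q τ₀⟩` with `χ(q τ₀) = ζ` (`monoidHomOfForallMemZpowers`), pulled back to
`G`, is continuous (trivial on the open subgroup `f(H)`), non-trivial, and `r(g) T = χ(g) T r(g)`
for all `g` (true on `f(H)` and at `τ₀`, and the set of such `g` is a subgroup); the kernel of `T`
is then `r(G)`-stable, hence zero by irreducibility, so `T` is invertible and `T⁻¹ r T = r ⊗ χ`.

For a finite Galois extension of fields `M/F` of characteristic zero with `Gal(M/F)` cyclic and
`f = absGaloisRestrict F M : Γ_M →ₜ* Γ_F` (`isOpenEmbedding_absGaloisRestrict`,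
`conj_absGaloisRestrict_mem_range`, `absGaloisQuot_eq_one_iff`) this is the statement that **an
irreducible Galois representation `ρ` of `Γ_F` whose restriction to `Γ_M` is reducible satisfies
`ρ ≅ ρ ⊗ χ` for a character `χ ≠ 1` of `Gal(M/F)`**
(`FramedGaloisRep.exists_twist_conj_of_not_isIrreducible_restrictField`) — the Galois shadow of the
cuspidality criterion of cyclic base change (Arthur–Clozel 1989, Ch. 3, Thm. 4.2 (a): for `M/F`
cyclic of prime degree and `π` cuspidal on `GL_n(𝔸_F)`, the base change `BC_{M/F}(π)` is cuspidal
iff `π ≇ π ⊗ η` for every character `η ≠ 1` of `Gal(M/F)`).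

## Main results

* `FramedRep.exists_twist_conj_of_not_isIrreducible_comp` — the abstract theorem.
* `FramedGaloisRep.exists_twist_conj_of_not_isIrreducible_restrictField` — the Galois form, `M/F`
  finite Galois with cyclic Galois group, characteristic zero.

The linear algebra (`exists_conj_eq_smul_of_mem_centralizer`: the eigenvector of conjugation in
the commutant; `FramedRep.exists_comm_ne_algebraMap_of_not_isIrreducible`: a reducible semisimple
representation has a non-scalar endomorphism) is in the companion file
`CliffordTwistDichotomyCommutant`.

## References

* A. H. Clifford, *Representations induced in an invariant subgroup*, Ann. of Math. 38 (1937),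
  533–550, §§1–3. [Clifford1937]
* J.-P. Serre, *Linear representations of finite groups*, GTM 42, §8.1 (representations of a
  normal subgroup), §2.2 (Schur's lemma). [SerreLinearRepresentations1977]
* J. Arthur, L. Clozel, *Simple algebras, base change, and the advanced theory of the trace
  formula*, Ann. of Math. Stud. 120 (1989), Ch. 3, Thm. 4.2. [ArthurClozelAMS120]
-/

noncomputable section

open Topology

namespace Literature.NumberTheory.GaloisRepresentations

universe u u' v

section Abstract

variable {G : Type u} {H : Type u'} [Group G] [TopologicalSpace G] [IsTopologicalGroup G]
  [Group H] [TopologicalSpace H] {A : Type v} [Field A] [TopologicalSpace A] [IsTopologicalRing A]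
  {n : ℕ}

namespace FramedRep

/-- **An irreducible representation with reducible restriction along a normal subgroup of finite
cyclic index is a non-trivial twist of itself** (Clifford).  Let `f : H →ₜ* G` be an open
embedding of topological groups with normal image, `q : G →* Q` a surjection onto a finite cyclic
group with `q g = 1 ↔ g ∈ f(H)`, `A` an algebraically closed topological field of characteristic
zero and `r : G →ₜ* GL_n(A)` irreducible with `r ∘ f` REDUCIBLE.  Then `P r P⁻¹ = r ⊗ χ` for some
`P ∈ GL_n(A)` and some continuous character `χ : G →ₜ* Aˣ` with `χ ∘ f = 1` and `χ ≠ 1`.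
[cite: Clifford1937, §§1–3] -/
theorem exists_twist_conj_of_not_isIrreducible_comp [IsAlgClosed A] [CharZero A] (f : H →ₜ* G)
    (hf : IsOpenEmbedding f) (hnorm : ∀ (g : G) (h : H), ∃ h' : H, g * f h * g⁻¹ = f h')
    {Q : Type*} [Group Q] [Finite Q] [IsCyclic Q] (q : G →* Q) (hqs : Function.Surjective q)
    (hq : ∀ g : G, q g = 1 ↔ g ∈ Set.range f) (r : FramedRep G A n) (hirr : r.IsIrreducible)
    (hred : ¬ FramedRep.IsIrreducible (r.comp f)) :
    ∃ (χ : G →ₜ* Aˣ) (P : GL (Fin n) A), (∀ h : H, χ (f h) = 1) ∧ χ ≠ 1 ∧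
      FramedRep.conj P r = r.twist χ := by
  classical
  -- a generator `q τ₀` of `Q`, of order `d`; `τ₀ ^ d = f σ_d`; `G = ⋃ₖ f(H) τ₀ ^ k`
  obtain ⟨g₀, hg₀⟩ := IsCyclic.exists_generator (α := Q)
  obtain ⟨τ₀, hτ₀⟩ := hqs g₀
  obtain ⟨d, hd_def⟩ : ∃ d : ℕ, orderOf g₀ = d := ⟨_, rfl⟩
  have hd : 0 < d := hd_def ▸ orderOf_pos g₀
  obtain ⟨σd, hσd⟩ : τ₀ ^ d ∈ Set.range f :=
    (hq _).1 (by rw [map_pow, hτ₀, ← hd_def, pow_orderOf_eq_one])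
  have hcover : ∀ g : G, ∃ (k : ℤ) (h : H), g = f h * τ₀ ^ k := fun g => by
    obtain ⟨j, hj⟩ := Subgroup.mem_zpowers_iff.1 (hg₀ (q g))
    obtain ⟨h, hh⟩ : g * τ₀ ^ (-j) ∈ Set.range f := (hq _).1 (by
      rw [map_mul, map_zpow, hτ₀, ← hj, ← zpow_add, add_neg_cancel, zpow_zero])
    exact ⟨j, h, by rw [hh, zpow_neg, inv_mul_cancel_right]⟩
  have hn : 0 < n := hirr.rank_pos
  haveI : Nonempty (Fin n) := ⟨⟨0, hn⟩⟩
  -- `r ∘ f` is semisimple (Clifford: `f(H)` is normal)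
  have hss : (FramedRep.toRepresentation (r.comp f)).IsSemisimpleRepresentation := by
    haveI : Representation.IsIrreducible r.toRepresentation := hirr
    haveI : (f.toMonoidHom.range).Normal := ⟨fun x hx g => by
      obtain ⟨h, rfl⟩ := MonoidHom.mem_range.1 hx
      obtain ⟨h', hh'⟩ := hnorm g h
      exact MonoidHom.mem_range.2 ⟨h', hh'.symm⟩⟩
    have h1 : FramedRep.toRepresentation (r.comp f) = r.toRepresentation.comp f.toMonoidHom := rfl
    rw [h1, Representation.isSemisimpleRepresentation_comp_iff_of_injective]
    exact RepresentationTheory.Semisimple.Representation.isSemisimpleRepresentation_restrictSubgroup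
      _ _ inferInstance
  -- a non-scalar matrix `T₀` in the commutant of `S = r(f(H))`
  obtain ⟨T₀, hT₀c, hT₀s⟩ := exists_comm_ne_algebraMap_of_not_isIrreducible hn hss hred
  set S : Set (Matrix (Fin n) (Fin n) A) := Set.range fun h : H => (r (f h)).val with hS_def
  have hmemE : ∀ T : Matrix (Fin n) (Fin n) A, T ∈ Subalgebra.centralizer A S ↔
      ∀ h : H, (r (f h)).val * T = T * (r (f h)).val := fun T => by
    rw [Subalgebra.mem_centralizer_iff, hS_def]
    exact Set.forall_mem_range
  have hT₀E : T₀ ∈ Subalgebra.centralizer A S := (hmemE T₀).2 hT₀c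
  -- `r(τ₀)⁻¹ S r(τ₀) ⊆ S` (normality)
  have hSconj : ∀ s ∈ S, ((r τ₀)⁻¹).val * s * (r τ₀).val ∈ S := by
    rintro _ ⟨h, rfl⟩
    obtain ⟨h', hh'⟩ := hnorm τ₀⁻¹ h
    rw [inv_inv] at hh'
    refine ⟨h', ?_⟩
    show (r (f h')).val = _
    rw [← hh', map_mul, map_mul, map_inv, Units.val_mul, Units.val_mul]
  -- `r(τ₀) ^ d = r(f σ_d)` commutes with the commutant
  have hbd : ∀ T ∈ Subalgebra.centralizer A S, ((r τ₀) ^ d).val * T = T * ((r τ₀) ^ d).val :=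
    fun T hT => by
      rw [← map_pow, ← hσd]
      exact (hmemE T).1 hT σd
  -- an element of the commutant commuting with `r(τ₀)` commutes with `r(G)`, hence is scalar
  have hfix : ∀ T ∈ Subalgebra.centralizer A S, (r τ₀).val * T = T * (r τ₀).val →
      ∃ c : A, T = algebraMap A (Matrix (Fin n) (Fin n) A) c := fun T hT hTb => by
    refine exists_eq_scalar_of_forall_commute hirr T fun g => ?_
    obtain ⟨k, h, rfl⟩ := hcover g
    rw [map_mul, map_zpow, Units.val_mul]
    have h1 : Commute T (r (f h)).val := ((hmemE T).1 hT h).symm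
    have h2 : Commute T (r τ₀).val := hTb.symm
    exact (h1.mul_right (h2.units_zpow_right k)).eq
  -- the core: an eigenmatrix `T` of conjugation by `r(τ₀)` in the commutant, eigenvalue `ζ ≠ 1`
  obtain ⟨ζ, T, hζd, hζ1, hT0, hTE, hbT⟩ :=
    exists_conj_eq_smul_of_mem_centralizer S (r τ₀) hd hSconj hbd hfix hT₀E hT₀s
  have hTc : ∀ h : H, (r (f h)).val * T = T * (r (f h)).val := (hmemE T).1 hTE
  have hζ0 : ζ ≠ 0 := fun h => by
    rw [h, zero_pow hd.ne'] at hζd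
    exact zero_ne_one hζd
  -- the character of `Q` with `q τ₀ ↦ ζ`, pulled back to `G`
  set ζu : Aˣ := Units.mk0 ζ hζ0 with hζu_def
  have hζu : orderOf ζu ∣ orderOf g₀ := by
    rw [hd_def]
    refine orderOf_dvd_of_pow_eq_one (Units.ext ?_)
    rw [Units.val_pow_eq_pow_val, Units.val_mk0, hζd, Units.val_one]
  set χ₀ : Q →* Aˣ := monoidHomOfForallMemZpowers hg₀ hζu with hχ₀_def
  have hχ₀ : χ₀ g₀ = ζu := monoidHomOfForallMemZpowers_apply_gen hg₀ hζu
  set χ₁ : G →* Aˣ := χ₀.comp q with hχ₁_def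
  have hχ₁f : ∀ h : H, χ₁ (f h) = 1 := fun h => by
    rw [hχ₁_def, MonoidHom.comp_apply, (hq (f h)).2 ⟨h, rfl⟩, map_one]
  -- continuity: a homomorphism trivial on the open subgroup `f(H)`
  have hcont : Continuous χ₁ := by
    apply continuous_of_continuousAt_one χ₁
    have h1 : ContinuousAt (χ₁ ∘ f) 1 := by
      have h2 : (χ₁ : G → Aˣ) ∘ f = fun _ => 1 := funext hχ₁f
      rw [h2]
      exact continuousAt_const
    have h3 := hf.continuousAt_iff.1 h1
    rwa [map_one] at h3
  let χ : G →ₜ* Aˣ := { toMonoidHom := χ₁, continuous_toFun := hcont }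
  have hχf : ∀ h : H, χ (f h) = 1 := fun h => hχ₁f h
  have hχτ : χ τ₀ = ζu := by
    show χ₀ (q τ₀) = ζu
    rw [hτ₀, hχ₀]
  -- `r(g) T = χ(g) T r(g)` for every `g`: the set of such `g` is a subgroup containing `f(H)`, `τ₀`
  have hrel : ∀ g : G, (r g).val * T = (χ g : A) • (T * (r g).val) := by
    let W : Subgroup G :=
      { carrier := {g | (r g).val * T = (χ g : A) • (T * (r g).val)}
        mul_mem' := fun {a b} ha hb => by
          simp only [Set.mem_setOf_eq] at ha hb ⊢
          rw [map_mul r a b, map_mul χ a b, Units.val_mul, Units.val_mul]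
          calc (r a).val * (r b).val * T = (r a).val * ((χ b : A) • (T * (r b).val)) := by
                rw [mul_assoc, hb]
            _ = (χ b : A) • ((χ a : A) • (T * (r a).val) * (r b).val) := by
                rw [mul_smul_comm, ← mul_assoc, ha]
            _ = ((χ a : A) * (χ b : A)) • (T * ((r a).val * (r b).val)) := by
                rw [smul_mul_assoc, smul_smul, mul_comm (χ b : A), mul_assoc]
        one_mem' := by
          simp only [Set.mem_setOf_eq, map_one, Units.val_one, one_mul, mul_one, one_smul]
        inv_mem' := fun {a} ha => by
          simp only [Set.mem_setOf_eq] at ha ⊢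
          rw [map_inv r a, map_inv χ a, Units.val_inv_eq_inv_val (χ a)]
          have h1 : T * ((r a)⁻¹).val = (χ a : A) • (((r a)⁻¹).val * T) := by
            calc T * ((r a)⁻¹).val = ((r a)⁻¹).val * ((r a).val * T) * ((r a)⁻¹).val := by
                  rw [Units.inv_mul_cancel_left]
              _ = ((r a)⁻¹).val * ((χ a : A) • (T * (r a).val)) * ((r a)⁻¹).val := by rw [ha]
              _ = (χ a : A) • (((r a)⁻¹).val * T) := by
                  rw [mul_smul_comm, smul_mul_assoc, mul_assoc, Units.mul_inv_cancel_right]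
          rw [h1, inv_smul_smul₀ (χ a).ne_zero] }
    have hWf : ∀ h : H, f h ∈ W := fun h => by
      show (r (f h)).val * T = (χ (f h) : A) • (T * (r (f h)).val)
      rw [hχf h, Units.val_one, one_smul]
      exact hTc h
    have hWτ : τ₀ ∈ W := by
      show (r τ₀).val * T = (χ τ₀ : A) • (T * (r τ₀).val)
      rw [hχτ, hζu_def, Units.val_mk0, ← smul_mul_assoc, ← hbT, Units.inv_mul_cancel_right]
    intro g
    obtain ⟨k, h, rfl⟩ := hcover g
    exact W.mul_mem (hWf h) (W.zpow_mem hWτ k)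
  have hrel' : ∀ g : G, T * (r g).val = ((χ g : A))⁻¹ • ((r g).val * T) := fun g => by
    rw [hrel g, inv_smul_smul₀ (χ g).ne_zero]
  -- `T` is invertible: its kernel is an `r(G)`-stable subspace, and `T ≠ 0`
  have hTunit : IsUnit T := by
    haveI : Representation.IsIrreducible r.toRepresentation := hirr
    let K : Subrepresentation r.toRepresentation :=
      { toSubmodule := LinearMap.ker (Matrix.toLin' T)
        apply_mem_toSubmodule := fun g v hv => by
          rw [LinearMap.mem_ker, Matrix.toLin'_apply] at hv ⊢
          rw [toRepresentation_apply_apply, Matrix.mulVec_mulVec, hrel' g, Matrix.smul_mulVec,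
            ← Matrix.mulVec_mulVec, hv, Matrix.mulVec_zero, smul_zero] }
    rcases eq_bot_or_eq_top K with hK | hK
    · have h1 : LinearMap.ker (Matrix.toLin' T) = ⊥ := congrArg Subrepresentation.toSubmodule hK
      have h2 := LinearMap.ker_eq_bot.1 h1
      have h3 : ⇑(Matrix.toLin' T) = T.mulVec := funext fun v => Matrix.toLin'_apply T v
      rw [h3] at h2
      exact Matrix.mulVec_injective_iff_isUnit.1 h2
    · exfalso
      have h1 : LinearMap.ker (Matrix.toLin' T) = ⊤ := congrArg Subrepresentation.toSubmodule hK
      exact hT0 (Matrix.toLin'.map_eq_zero_iff.1 (LinearMap.ker_eq_top.1 h1))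
  obtain ⟨P₀, hP₀⟩ := hTunit
  refine ⟨χ, P₀⁻¹, hχf, fun h1 => hζ1 ?_, ContinuousMonoidHom.ext fun g => Units.ext ?_⟩
  · -- `χ ≠ 1` since `χ τ₀ = ζ ≠ 1`
    have h2 := congrArg (fun χ' : G →ₜ* Aˣ => (χ' τ₀ : A)) h1
    simp only [ContinuousMonoidHom.coe_one, Pi.one_apply, Units.val_one] at h2
    rwa [hχτ, hζu_def, Units.val_mk0] at h2
  · -- `T⁻¹ r(g) T = χ(g) r(g)`
    rw [conj_apply, twist_apply, inv_inv, Units.val_mul, Units.val_mul, Units.val_mul,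
      coe_scalar_apply, ← Algebra.smul_def, mul_assoc, hP₀, hrel g, mul_smul_comm, ← mul_assoc,
      ← hP₀, Units.inv_mul, one_mul]

end FramedRep

end Abstract

section Galois

open Field

/-- **An irreducible Galois representation with reducible restriction to a cyclic layer is a
non-trivial twist of itself.**  Let `M/F` be a finite Galois extension of fields of characteristic
zero with cyclic Galois group, `A` an algebraically closed topological field of characteristic
zero, and `ρ : Γ_F → GL_n(A)` an IRREDUCIBLE framed Galois representation whose restriction
`ρ|_{Γ_M}` (`FramedGaloisRep.restrictField`, along `absGaloisRestrict F M`) is REDUCIBLE.  Then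
`P ρ P⁻¹ = ρ ⊗ χ` for some `P ∈ GL_n(A)` and a continuous character `χ ≠ 1` of `Γ_F` trivial on
(the image of) `Γ_M`, i.e. a non-trivial character of `Gal(M/F)` — the Galois shadow of the
cuspidality criterion of cyclic base change: `BC_{M/F}(π)` cuspidal iff `π ≇ π ⊗ η` for all
`η ≠ 1`. [cite: ArthurClozelAMS120, Ch. 3 Thm. 4.2 (a)] -/
theorem FramedGaloisRep.exists_twist_conj_of_not_isIrreducible_restrictField {F M : Type}
    [Field F] [Field M] [Algebra F M] [IsGalois F M] [CharZero F] [CharZero M]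
    [FiniteDimensional F M] [IsCyclic (M ≃ₐ[F] M)] {A : Type v} [Field A] [TopologicalSpace A]
    [IsTopologicalRing A] [IsAlgClosed A] [CharZero A] {n : ℕ} (ρ : FramedGaloisRep F A n)
    (hirr : ρ.IsIrreducible) (hred : ¬ (ρ.restrictField M).IsIrreducible) :
    ∃ (χ : absoluteGaloisGroup F →ₜ* Aˣ) (P : GL (Fin n) A),
      (∀ σ : absoluteGaloisGroup M, χ (absGaloisRestrict F M σ) = 1) ∧ χ ≠ 1 ∧
        FramedRep.conj P ρ = ρ.twist χ :=
  FramedRep.exists_twist_conj_of_not_isIrreducible_comp (absGaloisRestrict F M)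
    (isOpenEmbedding_absGaloisRestrict F M) (fun τ σ => by
      obtain ⟨σ', h⟩ := conj_absGaloisRestrict_mem_range F M τ σ
      exact ⟨σ', h.symm⟩)
    (absGaloisQuot F M) (absGaloisQuot_surjective F M) (fun τ => by
      rw [absGaloisQuot_eq_one_iff]
      rfl) ρ hirr hred

end Galois

end Literature.NumberTheory.GaloisRepresentations

end
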